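import Mathlib
import Literature.Computability.Complexity.CircuitPlug
import Literature.Computability.Complexity.StackBricksStrings
import Literature.Computability.MetaComplexity.Hirahara2020.HittingSetGenerators
import Literature.Computability.MetaComplexity.Oliveira2019.GapMrKtPMagnification
import HarnessLib

/-!
# Hirahara (CCC 2020; ToC 2023), Prop. 4.22 for `ℭ = AC⁰_d ∘ XOR`: the hitting-set-generator
# transfer to `MKtP` lower bounds, PROVED in the tree's model

S. Hirahara, *Non-disjoint promise problems from meta-computational view of pseudorandom generator
constructions*, Theory of Computing **19**(4) (2023) 1–61 (bib key `Hirahara2023NonDisjoint`;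
conference version 35th CCC (2020), LIPIcs 169, where Prop. 4.22 is Prop. 54). ALL QUOTATIONS AND
LOCATORS ARE FROM THE JOURNAL VERSION. Companion of `Hirahara2020/HittingSetGenerators.lean`, which
VENDORS Prop. 4.22 (instance `ℭ = AC⁰_d ∘ XOR`, the one used in the proof of Thm. 1.11) as the named
unproved fact `prop422_acdXor` and consumes it as a hypothesis `(h422 : prop422_acdXor)` in
`thm111Item4_of_item1`, `not_EXP_subset_NC1_of_thm429Hypothesis`, `thm111Item4_of_forall_thm429Hypothesis`
(hardness-magnification census rows R29/R60). This file PROVES the theorem that the printed proof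
establishes, over the definitions of that file and of `Hirahara2020/MKtPConstantDepthLowerBounds.lean`
(`IsACdXor`, `logThreshold`, `predThreshold`, `powThreshold`, `Circuit.SolvesPromise`,
`PromiseProblem.EventuallyUnsolvable`, `HSGAgainstLinearACdXor`, `Circuit.Avoids`, `seedImage`, `toInput`),
and discharges `h422` from the three consumers for EVERY reference machine.

## The printed statement and proof (verbatim)

**Proposition 4.22** (p. 39): *"Let ℭ be any circuit complexity class. Suppose that there exists a
hitting set generator G = {G_n : {0,1}^{O(log n)} → {0,1}^n}_{n∈ℕ} computable in time n^{O(1)} and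
secure against linear-size ℭ circuits. Then, for any constant k ∈ ℕ, for all sufficiently large
N ∈ ℕ, no NOT ∘ ℭ circuit of size N^k can solve […] MKtP[O(log N), N − 1] on input length N."*
Proof (p. 40): *"take a NOT ∘ ℭ circuit ¬C of size N^k that solves MKtP[c log N, N − 1] on inputs of
length N. We regard C as a circuit that takes m := N^k input bits by ignoring m − N input bits, and in
what follows we claim that the linear-size circuit C avoids G_m. For a string w ∈ {0,1}^m, denote by
w↾N the first N bits of w. Let z ∈ {0,1}^{d log m} be any seed of G_m. Since G_m(z)↾N can be described
by N ∈ ℕ and z ∈ {0,1}^{d log m} in time m^d, its Kt complexity is Kt(G_m(z)↾N) ≤ log N + |z| +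
d log m + o(log m) ≤ 4kd log N, which means that G_m(z)↾N is a Yes instance of MKtP[c log N, N − 1] and
thus G_m(z) is rejected by C. Now consider a string w ∼ {0,1}^m chosen uniformly at random. By a
standard counting argument, Kt(w↾N) ≥ N − 1 with probability at least 1/2; thus C accepts at least a
half of all inputs. Therefore, the function G_m is not secure against C."*

## What is proved here (no `sorry`)

* `hsg_transfer_acdXor` — **the transfer, for every NO threshold `s₂` under which the non-random
  strings are eventually at most half** (`#{u ∈ {0,1}^N | Kt_U(u) ≤ s₂(N)} ≤ 2^{N−1}` for all large
  `N`): a hitting set generator secure against linear-size `AC⁰_d ∘ XOR` circuits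
  (`HSGAgainstLinearACdXor d`) gives `∀ k, ∃ c, MKtP[c log N, s₂] ∉ i.o. AC⁰_d ∘ XOR(N^k)`. The proof
  is the printed one, step for step: the solver re-read on `m` inputs and negated
  (`exists_circuit_neg_restrict`, by the gate-list calculus of `Complexity/CircuitPlug.lean`: rename the
  inputs along `Fin.castLE`, append one NOT gate — free in `acWeight`, so size, `acDepth`, the basis
  `acXorBasis` and parities-at-the-bottom are kept; in the tree's model `NOT ∘ ℭ = ℭ`); the prefixes
  `G_m(z)↾N` are YES instances (`exists_eventually_levinKt_prefix_le`: `Kt ≤ c·⌊log₂ N⌋`, by the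
  ruler-machine programs of `KtViaRuler.lean` run on `⟨e, ⟨bin N, ⟨bin N, z⟩⟩⟩`, pattern of
  `UniversalMachine.levinKt_ones_le`); density by fibre counting (`card_filter_restrict`); contradiction
  with security at length `m`. Two harmless deviations: `m := N^{k+1}` (not `N^k`), so that `N ≤ m`
  also for `k = 0` and the solver of size `N^k ≤ m` is "linear-size" on `m` inputs exactly as the typed
  security class `IsACdXor d (fun n ↦ n)` demands; and `w↾N` pads with `false` when `|G_m(z)| < m`
  (the convention of `toInput`).
* `prop422_acdXor_powThreshold` — **Prop. 4.22 at every NO threshold `N^α`, `α < 1`, for EVERY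
  reference machine**: there the density is plain counting (fewer than `2^{⌊N^α⌋+1} ≤ 2^{N−1}` strings
  have `Kt ≤ ⌊N^α⌋`; `card_levinKt_le_of_add_two_le` with the sibling's
  `eventually_powThreshold_lt_predThreshold`). This is the form in which the proof of Thm. 1.11
  (Item 1 ⟹ Item 4, p. 44) consumes Prop. 4.22, whence the `h422`-free consequences
  `thm111Item4_of_thm111Item1` (Item 1 ⟹ Item 4 for every machine), `not_EXP_subset_NC1_of_thm429`
  (the R29 hypothesis at all depths for one machine, Thm. 4.29 and the author's remark after Thm. 1.11
  give `EXP ⊄ NC¹`) and `thm111Item4_of_thm429`.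
* `prop422_acdXor_of_inputBounded` — **the vendored fact's body (`MKtP[c log N, N − 1]`) for every
  INPUT-BOUNDED reference machine** (`Oliveira2019.InputBounded U`: a program halting within budget `t`
  has length `≤ k·t`; the standing hypothesis of the tree's `Oliveira2019` renderings), via
  `eventually_card_levinKt_le_pred_of_inputBounded`.

## Rendering of the counting sentence (F-rule)

THE DENSITY STEP IS A HYPOTHESIS OF THE CORE THEOREM, DISCHARGED IN TWO REGIMES. As a claim about the
typed NO side `{x : Kt_U(x) > N − 1}` of `U.gapMKtP _ predThreshold`, the printed *"Kt(w↾N) ≥ N − 1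
with probability at least 1/2"* is used as `#{x ∈ {0,1}^N : Kt_U(x) ≤ N − 1} ≤ 2^{N−1}`. For a
concrete universal Turing machine this is the standard count (printing `x` costs `≥ |x|` steps, so a
witness `|prog| + ⌈log₂ t⌉ ≤ N − 1` of a string of length `N ≥ 3` has `|prog| ≤ N − 3`). The tree's
ABSTRACT reference machines (`UniversalMachine`: fields `run_mono`, `polyTime`, `sim`, `print`)
constrain `Kt` only from above, plus output-uniqueness of programs, which yields exactly
`UniversalMachine.ncard_setOf_levinKt_lt` (`#{x : Kt(x) < m} < 2^m`) — at `m = N` one NO instance per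
length, not half; nothing in the four fields bounds the running time of a program from below by the
length of its output. The tree's standing remedy is `Oliveira2019.InputBounded` (a witness with
`|prog| = N − 1` would have `t ≤ 1`, so `N − 1 ≤ k`): under it fewer than `2^{N−1}` strings of ANY
length have `Kt ≤ N − 1` for `N ≥ k + 2` (`ncard_setOf_run_le_lt`). At the thresholds `N^α`, `α < 1` —
the only ones the census consumers need — no hypothesis on `U` is used. The vendored `prop422_acdXor`
(all machines, threshold `N − 1`) therefore stays a named fact in `HittingSetGenerators.lean`; this file
proves it for input-bounded machines and proves its every use. No sentence of the source is
contradicted: the source works with a fixed concrete universal machine.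
-/

namespace Literature.Computability.MetaComplexity.Hirahara2020

open _root_.Computability Filter Topology Literature.Computability.Complexity
open Literature.Computability.MetaComplexity UniversalMachine OliveiraPichSanthanam2019 Finset

/-! ### Step 1: re-reading an `N`-input circuit on `m ≥ N` inputs and negating it -/

/-- **`¬C` regarded as an `m`-input circuit** (p. 40: *"We regard C as a circuit that takes
m := N^k input bits by ignoring m − N input bits"*, then *"¬C(w) := 1 − C(w)"*): for `N ≤ m` and an
`N`-input circuit `E` there is an `m`-input circuit computing `w ↦ ¬E(w↾N)` with the same
`acWeight`-size, no larger `acDepth`, over `acXorBasis` if `E` is, and with parities at the bottom if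
`E` has them there (the `N` inputs are renamed along `Fin.castLE`, one free NOT gate is appended).
[cite: Hirahara2023NonDisjoint, proof of Prop. 4.22 (p. 40 L4–7)] -/
theorem exists_circuit_neg_restrict {N m : ℕ} (E : Circuit (Fin N)) (h : N ≤ m) :
    ∃ D : Circuit (Fin m),
      (∀ w, D.eval w = !E.eval (fun i => w (Fin.castLE h i))) ∧
      D.acDepth ≤ E.acDepth ∧ D.sizeWith acWeight = E.sizeWith acWeight ∧
      (E.IsOver acXorBasis → D.IsOver acXorBasis) ∧ (E.XorAtBottom → D.XorAtBottom) := by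
  classical
  let ρ : Fin N → Fin m ⊕ ℕ := fun i => Sum.inl (Fin.castLE h i)
  have hP := GateList.carries_plug (gs := ([] : List (Gate (Fin m)))) (ρ := ρ) E
    (f := fun i x => x (Fin.castLE h i)) (d := 0) (fun i => GateList.carries_input [] (Fin.castLE h i))
  have hQ := GateList.carries_notWire hP
  have hwfP : GateList.WF (GateList.plug [] ρ E).1 :=
    GateList.wf_plug GateList.WF.nil (GateList.wiresOK_inl 0 _) E
  have hwfQ := GateList.wf_notWire hwfP hP.outOK
  refine ⟨GateList.toCircuit _ _ hwfQ hQ.outOK, fun w => GateList.eval_toCircuit hwfQ hQ w,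
    by simpa using GateList.acDepth_toCircuit_le hwfQ hQ, ?_, fun hE => ?_, fun hE => ?_⟩
  · simp [GateList.toCircuit, Circuit.sizeWith, GateList.notWire, GateList.plug_fst, List.map_map,
      Function.comp_def]
  · exact GateList.isOver_toCircuit hwfQ hQ.outOK
      (GateList.fn_mem_notWire acBasis_subset_acXorBasis (GateList.fn_mem_plug (by simp) ρ hE) _)
  · intro g hg hpar har a
    simp only [GateList.toCircuit, GateList.notWire, GateList.plug_fst, List.nil_append,
      List.mem_append, List.mem_map, List.mem_singleton, List.length_map] at hg
    rcases hg with ⟨g', hg', rfl⟩ | rfl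
    · have h1 : ((g'.args a).isLeft = true) := hE g' hg' hpar har a
      obtain ⟨i, hi⟩ := Sum.isLeft_iff.1 h1
      change (GateList.shiftWire ρ 0 (g'.args a)).isLeft = true
      rw [hi]
      rfl
    · exact absurd har (by simp [GateList.notGate])

/-! ### Step 2: reading the first `N` of `m` input bits — strings and counting -/

/-- The first `N` bits of a string, read as an `N`-bit input, spell `List.takeD N w false`. [folklore] -/
private theorem ofFn_getD_eq_takeD (w : List Bool) (N : ℕ) :
    List.ofFn (fun i : Fin N => w.getD i false) = List.takeD N w false := by
  induction N generalizing w with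
  | zero => simp
  | succ N ih =>
    cases w with
    | nil => simp
    | cons b t =>
      rw [List.ofFn_succ, List.takeD_succ]
      exact congr_arg (List.cons b) (ih t)

/-- Restricting `toInput m w` to the first `N ≤ m` coordinates gives the string `takeD N w`. [folklore] -/
private theorem ofFn_toInput_castLE {N m : ℕ} (h : N ≤ m) (w : List Bool) :
    List.ofFn (fun i : Fin N => toInput m w (Fin.castLE h i)) = List.takeD N w false := by
  simpa [toInput] using ofFn_getD_eq_takeD w N

/-- **Fibre counting** (the step *"thus C accepts at least a half of all inputs"* of p. 40, for
`w ∼ {0,1}^m` versus `w↾N ∼ {0,1}^N`): a property of the first `N` of `m` input bits holds for exactly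
`2^{m−N} · #{u ∈ {0,1}^N | P u}` of the `m`-bit inputs. [cite: Hirahara2023NonDisjoint, proof of Prop. 4.22 (p. 40, density step)] -/
theorem card_filter_restrict {N m : ℕ} (h : N ≤ m) (P : (Fin N → Bool) → Prop) [DecidablePred P] :
    #(univ.filter fun w : Fin m → Bool => P fun i => w (Fin.castLE h i)) =
      2 ^ (m - N) * #(univ.filter P) := by
  obtain ⟨r, rfl⟩ := Nat.exists_eq_add_of_le h
  rw [Nat.add_sub_cancel_left]
  let e : (Fin (N + r) → Bool) ≃ (Fin N → Bool) × (Fin r → Bool) :=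
    (finSumFinEquiv.symm.arrowCongr (Equiv.refl Bool)).trans
      (Equiv.sumArrowEquivProdArrow (Fin N) (Fin r) Bool)
  have he : ∀ w : Fin (N + r) → Bool, (e w).1 = fun i => w (Fin.castLE h i) := by
    intro w
    funext i
    simp [e, Equiv.sumArrowEquivProdArrow, Equiv.arrowCongr, Fin.castAdd]
  have h1 : #(univ.filter fun w : Fin (N + r) → Bool => P fun i => w (Fin.castLE h i)) =
      #(univ.filter fun p : (Fin N → Bool) × (Fin r → Bool) => P p.1) := by
    rw [← Finset.card_map e.toEmbedding]
    congr 1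
    ext p
    simp only [Finset.mem_map_equiv, Finset.mem_filter, Finset.mem_univ, true_and]
    rw [← he (e.symm p), Equiv.apply_symm_apply]
  rw [h1, ← Finset.univ_product_univ, Finset.filter_product_left (fun u : Fin N → Bool => P u),
    Finset.card_product]
  simp [mul_comm]

/-- Strings of length `N` with a property implied by membership in a finite set of strings are at
most as many as that set. [folklore] -/
private theorem card_filter_le_ncard {N : ℕ} {S : Set (List Bool)} (hS : S.Finite)
    (P : (Fin N → Bool) → Prop) [DecidablePred P] (h : ∀ u : Fin N → Bool, P u → List.ofFn u ∈ S) :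
    #(univ.filter P) ≤ S.ncard := by
  calc #(univ.filter P) = #((univ.filter P).image List.ofFn) :=
        (Finset.card_image_of_injective _ List.ofFn_injective).symm
    _ = (((univ.filter P).image List.ofFn : Finset (List Bool)) : Set (List Bool)).ncard :=
        (Set.ncard_coe_finset _).symm
    _ ≤ S.ncard := Set.ncard_le_ncard (fun x hx => by
        obtain ⟨u, hu, rfl⟩ := Finset.mem_image.1 (Finset.mem_coe.1 hx)
        exact h u (Finset.mem_filter.1 hu).2) hS

/-- **At least half**: if at most `2^{N−1}` of the strings of length `N ≥ 1` have `Kt ≤ s`, then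
`2^N ≤ 2 · #{u ∈ {0,1}^N | Kt(u) > s}`. [folklore] -/
private theorem two_pow_le_two_mul_card_lt (U : UniversalMachine) {N : ℕ} (hN : 1 ≤ N) {s : ℕ}
    (h : #(univ.filter fun u : Fin N → Bool => U.levinKt (List.ofFn u) ≤ (s : ℕ∞)) ≤ 2 ^ (N - 1)) :
    2 ^ N ≤ 2 * #(univ.filter fun u : Fin N → Bool => (s : ℕ∞) < U.levinKt (List.ofFn u)) := by
  have hsum := Finset.card_filter_add_card_filter_not
    (s := (univ : Finset (Fin N → Bool))) (fun u : Fin N → Bool => U.levinKt (List.ofFn u) ≤ (s : ℕ∞))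
  simp only [not_le, Finset.card_univ, Fintype.card_fun, Fintype.card_bool, Fintype.card_fin] at hsum
  have h2 : 2 ^ N = 2 * 2 ^ (N - 1) := by
    rw [← pow_succ']; congr 1; omega
  omega

/-- The strings printed by programs of length `≤ L` (at any time budget) are fewer than `2^{L+1}`,
and form a finite set (a program prints at most one string). [folklore] -/
private theorem ncard_setOf_run_le_lt (U : UniversalMachine) (L : ℕ) :
    {x | ∃ prog t, U.run prog t = some x ∧ prog.length ≤ L}.Finite ∧
      {x | ∃ prog t, U.run prog t = some x ∧ prog.length ≤ L}.ncard < 2 ^ (L + 1) := by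
  set S : Set (List Bool) := {x | ∃ prog t, U.run prog t = some x ∧ prog.length ≤ L}
  have hS : ∀ x : S, ∃ prog, (∃ t, U.run prog t = some x.1) ∧ prog.length < L + 1 := fun x => by
    obtain ⟨prog, t, h1, h2⟩ := x.2
    exact ⟨prog, ⟨t, h1⟩, by omega⟩
  choose f hf hfl using hS
  let g : S → Σ k : Fin (L + 1), List.Vector Bool k := fun x => ⟨⟨(f x).length, hfl x⟩, ⟨f x, rfl⟩⟩
  have hg : Function.Injective g := by
    intro x x' h
    have h' : f x = f x' :=
      congr_arg (fun s : Σ k : Fin (L + 1), List.Vector Bool k => s.2.toList) h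
    obtain ⟨t, ht⟩ := hf x
    obtain ⟨t', ht'⟩ := hf x'
    rw [h'] at ht
    exact Subtype.ext (U.run_output_unique ht ht')
  haveI : Finite S := Finite.of_injective g hg
  refine ⟨Set.toFinite S, ?_⟩
  calc S.ncard = Nat.card S := (Nat.card_coe_set_eq S).symm
    _ ≤ Nat.card (Σ k : Fin (L + 1), List.Vector Bool k) := Nat.card_le_card_of_injective g hg
    _ = ∑ k ∈ Finset.range (L + 1), 2 ^ k := by
      rw [Nat.card_eq_fintype_card, Fintype.card_sigma]
      simp only [card_vector, Fintype.card_bool]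
      exact Fin.sum_univ_eq_sum_range (fun k => 2 ^ k) (L + 1)
    _ < 2 ^ (L + 1) := Nat.geomSum_lt le_rfl fun k hk => Finset.mem_range.mp hk

/-- **Density for an input-bounded machine at the threshold `N − 1`**: for all large `N`, at most
`2^{N−1}` strings of length `N` have `Kt ≤ N − 1` — a witness `|prog| + ⌈log₂ t⌉ ≤ N − 1` with
`|prog| ≤ k·t` has `|prog| ≤ N − 2` once `N ≥ k + 2` (if `|prog| = N − 1` then `t ≤ 1`), and fewer
than `2^{N−1}` strings have such short programs — the printed *"By a standard counting argument,
Kt(w↾N) ≥ N − 1 with probability at least 1/2"* in the regime where the tree's abstract machines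
support it (module docstring, RENDERING). [cite: Hirahara2023NonDisjoint, proof of Prop. 4.22 (p. 40, "standard counting argument")] -/
theorem eventually_card_levinKt_le_pred_of_inputBounded (U : UniversalMachine)
    (hU : Oliveira2019.InputBounded U) :
    ∀ᶠ N : ℕ in atTop, #(univ.filter fun u : Fin N → Bool =>
      U.levinKt (List.ofFn u) ≤ (predThreshold N : ℕ)) ≤ 2 ^ (N - 1) := by
  obtain ⟨k, hk⟩ := hU
  filter_upwards [eventually_ge_atTop (k + 2)] with N hN
  classical
  obtain ⟨hfin, hlt⟩ := ncard_setOf_run_le_lt U (N - 2)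
  have hle := card_filter_le_ncard hfin
    (fun u : Fin N → Bool => U.levinKt (List.ofFn u) ≤ (predThreshold N : ℕ)) (fun u hu => by
      obtain ⟨prog, t, hrun, hpt⟩ := U.levinKt_le_coe_iff.1 hu
      refine ⟨prog, t, hrun, ?_⟩
      have hkt := hk prog t _ hrun
      unfold predThreshold at hpt
      by_contra hcon
      have hlen : prog.length = N - 1 := by omega
      have hclog : Nat.clog 2 t = 0 := by omega
      have ht : t ≤ 1 := by
        by_contra ht
        exact absurd hclog (Nat.pos_iff_ne_zero.1 (Nat.clog_pos one_lt_two (by omega)))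
      have : prog.length ≤ k := hkt.trans (by nlinarith)
      omega)
  have h2 : N - 2 + 1 = N - 1 := by omega
  rw [h2] at hlt
  omega

/-- **Density at a sublinear threshold, for every machine**: if `s(N) + 2 ≤ N` then at most
`2^{N−1}` strings of length `N` have `Kt ≤ s(N)` (plain counting: fewer than `2^{s+1}` strings have
`Kt ≤ s`) — the printed *"standard counting argument"* at a sublinear threshold.
[cite: Hirahara2023NonDisjoint, proof of Prop. 4.22 (p. 40, "standard counting argument")] -/
theorem card_levinKt_le_of_add_two_le (U : UniversalMachine) {N s : ℕ} (hs : s + 2 ≤ N) :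
    #(univ.filter fun u : Fin N → Bool => U.levinKt (List.ofFn u) ≤ (s : ℕ∞)) ≤ 2 ^ (N - 1) := by
  classical
  have hle := card_filter_le_ncard (U.finite_setOf_levinKt_lt (s + 1))
    (fun u : Fin N → Bool => U.levinKt (List.ofFn u) ≤ (s : ℕ∞)) (fun u hu =>
      lt_of_le_of_lt hu (by exact_mod_cast Nat.lt_succ_self s))
  have hlt := U.ncard_setOf_levinKt_lt (s + 1)
  calc _ ≤ _ := hle
    _ ≤ 2 ^ (s + 1) := hlt.le
    _ ≤ 2 ^ (N - 1) := Nat.pow_le_pow_right (by norm_num) (by omega)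

/-! ### Step 3: the first `N` bits of `G_m(z)` have `Kt = O(log N)` -/

/-- **Ruler programs** (the pattern of `UniversalMachine.levinKt_ones_le`): for `g ∈ FP` there is a
constant `c` with `Kt(g(⟨expPad 1 (bin N), ⟨bin N, w⟩⟩)) ≤ |w| + c·⌊log₂ N⌋ + c` whenever `|w| ≤ N` —
the `U`-program `⟨e, ⟨bin N, ⟨bin N, w⟩⟩⟩` of the ruler machine of `g` (`KtViaRuler`) prints that
value in time `poly(N)`. (Folklore consequence of Levin's definition, OPS21 Def. 2.1.)
[cite: OliveiraPichSanthanam2021, Def. 2.1 (Kt; the bound is folklore)] -/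
theorem exists_levinKt_ruler_apply_le (U : UniversalMachine) {g : List Bool → List Bool}
    (hg : g ∈ FP) :
    ∃ c : ℕ, ∀ (N : ℕ) (w : List Bool), w.length ≤ N →
      U.levinKt (g (boolPair (expPad 1 (encodeNat N)) (boolPair (encodeNat N) w))) ≤
        (w.length + c * Nat.log 2 N + c : ℕ) := by
  obtain ⟨M, A, B, hM⟩ := exists_outputsWithin_ruler hg
  obtain ⟨e, p, hsim⟩ := U.exists_levinKt_le_of_outputsWithin M
  obtain ⟨d, -, hd⟩ := UHSParam.exists_pow_bound p
  set K : ℕ := A * 5 ^ B + A + 2 with hK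
  set D : ℕ := B * 2 ^ d with hD
  set c₁ : ℕ := Nat.clog 2 (K ^ (2 ^ d)) with hc₁
  set R : ℕ := 2 * e.length + 10 + c₁ + 2 * D with hR
  refine ⟨4 + D + R, fun N w hwN => ?_⟩
  set k : ℕ := Nat.log 2 N with hk
  have hrun := hM (encodeNat N) (boolPair (encodeNat N) w)
  have hKt := hsim _ _ _ hrun
  refine hKt.trans ?_
  have hul : (encodeNat N).length ≤ k + 1 := TM2Pass.length_encodeNat_le N
  have h2u : 2 ^ (encodeNat N).length ≤ 2 * N + 1 := by
    rcases Nat.eq_zero_or_pos N with hN | hN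
    · subst hN
      simp [encodeNat, encodeNum]
    · calc 2 ^ (encodeNat N).length ≤ 2 ^ (Nat.log 2 N + 1) :=
            Nat.pow_le_pow_right (by norm_num) (TM2Pass.length_encodeNat_le N)
        _ = 2 * 2 ^ Nat.log 2 N := by rw [pow_succ, mul_comm]
        _ ≤ 2 * N := Nat.mul_le_mul_left 2 (Nat.pow_log_le_self 2 hN.ne')
        _ ≤ 2 * N + 1 := Nat.le_succ _
  have hkN : k ≤ N := Nat.log_le_self 2 N
  have hpay : (boolPair (encodeNat N) w).length ≤ N + 2 * k + 4 := by
    rw [length_boolPair]; omega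
  have hZ : 2 ^ (encodeNat N).length + (boolPair (encodeNat N) w).length ≤ 5 * (N + 2) := by omega
  set t : ℕ := A * (2 ^ (encodeNat N).length + (boolPair (encodeNat N) w).length) ^ B + A with ht
  have hMB : 1 ≤ (N + 2) ^ B := Nat.one_le_pow _ _ (by omega)
  have ht2 : t + 2 ≤ K * (N + 2) ^ B := by
    have h1 : (2 ^ (encodeNat N).length + (boolPair (encodeNat N) w).length) ^ B ≤
        5 ^ B * (N + 2) ^ B := by
      rw [← mul_pow]; exact Nat.pow_le_pow_left hZ B
    have h2 : A * (2 ^ (encodeNat N).length + (boolPair (encodeNat N) w).length) ^ B ≤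
        A * (5 ^ B * (N + 2) ^ B) := Nat.mul_le_mul_left A h1
    have h3 : A + 2 ≤ (A + 2) * (N + 2) ^ B := Nat.le_mul_of_pos_right _ hMB
    calc t + 2 = A * (2 ^ (encodeNat N).length + (boolPair (encodeNat N) w).length) ^ B + (A + 2) := by
          rw [ht]; ring
      _ ≤ A * (5 ^ B * (N + 2) ^ B) + (A + 2) * (N + 2) ^ B := add_le_add h2 h3
      _ = K * (N + 2) ^ B := by rw [hK]; ring
  have hp : p.eval t ≤ K ^ (2 ^ d) * (N + 2) ^ (B * 2 ^ d) := by
    have h1 := hd t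
    calc p.eval t ≤ (t + 2) ^ (2 ^ d) := by omega
      _ ≤ (K * (N + 2) ^ B) ^ (2 ^ d) := Nat.pow_le_pow_left ht2 _
      _ = K ^ (2 ^ d) * (N + 2) ^ (B * 2 ^ d) := by rw [mul_pow, ← pow_mul]
  have hclog : Nat.clog 2 (p.eval t) ≤ c₁ + D * (k + 2) := by
    calc Nat.clog 2 (p.eval t) ≤ Nat.clog 2 (K ^ (2 ^ d) * (N + 2) ^ (B * 2 ^ d)) :=
          Nat.clog_mono_right 2 hp
      _ ≤ Nat.clog 2 (K ^ (2 ^ d)) + Nat.clog 2 ((N + 2) ^ (B * 2 ^ d)) := clog_two_mul_le _ _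
      _ ≤ c₁ + (B * 2 ^ d) * Nat.clog 2 (N + 2) := by
          rw [hc₁]; exact Nat.add_le_add_left (clog_two_pow_le _ _) _
      _ ≤ c₁ + D * (k + 2) := by
          rw [hD]; exact Nat.add_le_add_left (Nat.mul_le_mul_left _ (clog_two_add_two_le N)) _
  have hw : (boolPair (encodeNat N) (boolPair (encodeNat N) w)).length ≤ w.length + 4 * k + 8 := by
    rw [length_boolPair, length_boolPair]; omega
  have hsum : (boolPair (encodeNat N) (boolPair (encodeNat N) w)).length + (2 * e.length + 2) +
      Nat.clog 2 (p.eval t) ≤ w.length + (4 + D) * k + R := by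
    have : (w.length + 4 * k + 8) + (2 * e.length + 2) + (c₁ + D * (k + 2)) =
        w.length + (4 + D) * k + R := by
      rw [hR]; ring
    calc _ ≤ (w.length + 4 * k + 8) + (2 * e.length + 2) + (c₁ + D * (k + 2)) :=
          add_le_add (add_le_add hw le_rfl) hclog
      _ = w.length + (4 + D) * k + R := this
  have hfin : w.length + (4 + D) * k + R ≤ w.length + (4 + D + R) * k + (4 + D + R) := by
    have h1 : (4 + D) * k ≤ (4 + D + R) * k := Nat.mul_le_mul_right k (by omega)
    omega
  exact_mod_cast hsum.trans hfin

/-- **`Kt((G_m(z))↾N) = O(log N)`** (p. 40 L5–6: *"(G_m(z))↾N ∈ MKtP[O(log N), N − 1] is a YES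
instance for every seed z, since (G_m(z))↾N can be described by N and the O(log m)-bit seed z in
polynomial time"*): for `F ∈ FP`, `G_m(z) = F(⟨1^m, z⟩)`, `m = N^{k+1}` and seeds of length
`≤ c_G·⌊log₂ m⌋ + c_G`, the `N`-bit prefix of `G_m(z)` has `Kt ≤ c·⌊log₂ N⌋` for all large `N`.
[cite: Hirahara2023NonDisjoint, proof of Prop. 4.22 (p. 40 L5–6)] -/
theorem exists_eventually_levinKt_prefix_le (U : UniversalMachine) {F : List Bool → List Bool}
    (hF : F ∈ FP) (k cG : ℕ) :
    ∃ c : ℕ, ∀ᶠ N : ℕ in atTop, ∀ z : List Bool, z.length ≤ cG * Nat.log 2 (N ^ (k + 1)) + cG →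
      U.levinKt (List.takeD N (F (boolPair (unaryEncodeNat (N ^ (k + 1))) z)) false) ≤
        (c * Nat.log 2 N : ℕ) := by
  -- the polynomial-time function `⟨r, ⟨u, z⟩⟩ ↦ (G_{n^{k+1}}(z))↾n`, `n = min ⟦u⟧ |r|`, run by the
  -- ruler machine on `⟨bin N, ⟨bin N, z⟩⟩` (so `r = expPad 1 (bin N)`, `u = bin N`, `n = N`)
  let onesF : List Bool → List Bool := binToUnaryFn ∘ pairFn fstP (fstP ∘ sndP)
  let g : List Bool → List Bool := fstP ∘ Brick.padTakeFn ∘ pairFn onesF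
    (F ∘ pairFn (OracleCompose.padFn (Polynomial.X ^ (k + 1)) ∘ pairFn onesF (fun _ => []))
      (sndP ∘ sndP))
  have honesF : onesF ∈ FP :=
    comp_mem_FP binToUnaryFn_mem_FP (pairFn_mem_FP fstP_mem_FP (comp_mem_FP fstP_mem_FP sndP_mem_FP))
  have hg : g ∈ FP :=
    comp_mem_FP fstP_mem_FP (comp_mem_FP Brick.padTakeFn_mem_FP (pairFn_mem_FP honesF
      (comp_mem_FP hF (pairFn_mem_FP (comp_mem_FP (OracleCompose.padFn_mem_FP _)
        (pairFn_mem_FP honesF (const_mem_FP _))) (comp_mem_FP sndP_mem_FP sndP_mem_FP)))))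
  have hgapply : ∀ (r u z : List Bool) (n : ℕ), min (bitsToNat u) r.length = n →
      g (boolPair r (boolPair u z)) =
        List.takeD n (F (boolPair (unaryEncodeNat (n ^ (k + 1))) z)) false := by
    intro r u z n hn
    simp [g, onesF, hn, OracleCompose.padFn_apply, OracleCompose.unaryEncodeNat_eq_replicate, ones]
  obtain ⟨c, hc⟩ := exists_levinKt_ruler_apply_le U hg
  obtain ⟨N₁, hN₁⟩ := eventually_mul_log_add_le_powThreshold (cG * (k + 1) + cG) zero_lt_one
  refine ⟨2 * (cG * (k + 1)) + cG + 2 * c, ?_⟩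
  filter_upwards [eventually_ge_atTop N₁, eventually_ge_atTop 2] with N hN hN2 z hz
  have hℓ1 : 1 ≤ Nat.log 2 N := Nat.log_pos one_lt_two hN2
  have hlogm : Nat.log 2 (N ^ (k + 1)) ≤ (k + 1) * (Nat.log 2 N + 1) := by
    have h1 : N < 2 ^ (Nat.log 2 N + 1) := Nat.lt_pow_succ_log_self one_lt_two N
    have h2 : N ^ (k + 1) ≤ (2 ^ (Nat.log 2 N + 1)) ^ (k + 1) := Nat.pow_le_pow_left h1.le _
    calc Nat.log 2 (N ^ (k + 1)) ≤ Nat.log 2 ((2 ^ (Nat.log 2 N + 1)) ^ (k + 1)) :=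
          Nat.log_mono_right h2
      _ = (k + 1) * (Nat.log 2 N + 1) := by rw [← pow_mul, Nat.log_pow one_lt_two]; ring
  have hA : cG * (k + 1) ≤ cG * (k + 1) * Nat.log 2 N := Nat.le_mul_of_pos_right _ hℓ1
  have hB : cG ≤ cG * Nat.log 2 N := Nat.le_mul_of_pos_right _ hℓ1
  have hC : c ≤ c * Nat.log 2 N := Nat.le_mul_of_pos_right _ hℓ1
  have hz' : z.length ≤ cG * (k + 1) * Nat.log 2 N + cG * (k + 1) + cG :=
    hz.trans (by nlinarith [Nat.mul_le_mul_left cG hlogm])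
  have hzN : z.length ≤ N := by
    have h1 := hN₁ N hN
    have hp1 : powThreshold 1 N = N := by simp [powThreshold]
    rw [hp1] at h1
    nlinarith
  have hn : min (bitsToNat (encodeNat N)) (expPad 1 (encodeNat N)).length = N := by
    rw [bitsToNat_encodeNat, length_expPad, pow_one]
    have h2 : (encodeNat N).length = N.size := TM2Pass.length_encodeNat_eq_size N
    have h3 : N < 2 ^ N.size := Nat.lt_size_self N
    rw [h2]
    omega
  have hKt := hc N z hzN
  rw [hgapply _ _ z N hn] at hKt
  refine hKt.trans ?_
  norm_cast
  nlinarith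

/-! ### Step 4: the transfer (Prop. 4.22) -/

/-- **Prop. 4.22 for `ℭ = AC⁰_d ∘ XOR`, proved — for every NO threshold under which the non-random
strings are eventually at most half.** If `G_m(z) = F(⟨1^m, z⟩)` (`F ∈ FP`, seeds `O(log m)`) is a
hitting set generator secure against linear-size `AC⁰_d ∘ XOR` circuits, and for all large `N` at most
`2^{N−1}` strings of length `N` have `Kt ≤ s₂(N)`, then for every `k` some `MKtP[c log N, s₂]` is, for
all large `N`, solved by no `AC⁰_d ∘ XOR` circuit of size `N^k`. The printed proof, verbatim in
structure: a solver `C` at length `N` is re-read on `m := N^{k+1}` inputs (`≥ N^k`, so `C` is of size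
`≤ m`, and `m ≥ N` also for `k = 0`) and negated (`exists_circuit_neg_restrict`); `¬C` rejects every
`G_m(z)` because `(G_m(z))↾N` is a YES instance (`exists_eventually_levinKt_prefix_le`) and accepts at
least half of `{0,1}^m` because `C` rejects the NO instances, which are at least half of `{0,1}^N`
(the density hypothesis; fibre counting `card_filter_restrict`) — so `¬C` avoids `G_m`, contradicting
its security at length `m`. The density hypothesis is exactly the printed *"By a standard counting
argument, Kt(w↾N) ≥ N − 1 with probability at least 1/2"* (p. 40 L6), isolated as a hypothesis because
for the tree's abstract reference machines it is available at the typed threshold `N − 1` only under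
input-boundedness (`prop422_acdXor_of_inputBounded`), while at every threshold `N^α`, `α < 1`, it is
plain counting (`prop422_acdXor_powThreshold`). [cite: Hirahara2023NonDisjoint, Prop. 4.22 (p. 39) and its proof (p. 40 L1–8)] -/
theorem hsg_transfer_acdXor (U : UniversalMachine) {d : ℕ} (hG : HSGAgainstLinearACdXor d)
    (s₂ : ℕ → ℕ) (hdens : ∀ᶠ N : ℕ in atTop,
      #(univ.filter fun u : Fin N → Bool => U.levinKt (List.ofFn u) ≤ (s₂ N : ℕ)) ≤ 2 ^ (N - 1))
    (k : ℕ) :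
    ∃ c : ℕ, (U.gapMKtP (logThreshold c) s₂).EventuallyUnsolvable (IsACdXor d fun N => N ^ k) := by
  classical
  obtain ⟨F, cG, hF, hHSG⟩ := hG
  obtain ⟨c, hc⟩ := exists_eventually_levinKt_prefix_le U hF k cG
  refine ⟨c, ?_⟩
  have hT : Tendsto (fun N : ℕ => N ^ (k + 1)) atTop atTop :=
    Filter.tendsto_pow_atTop (Nat.succ_ne_zero k)
  have hHSG' := hT.eventually hHSG
  unfold PromiseProblem.EventuallyUnsolvable
  filter_upwards [hHSG', hc, hdens, eventually_ge_atTop 1] with N hN hcN hdN hN1 E hE hsol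
  have hNm : N ≤ N ^ (k + 1) := Nat.le_self_pow (Nat.succ_ne_zero k) N
  obtain ⟨D, hDeval, hDdepth, hDsize, hDover, hDxor⟩ := exists_circuit_neg_restrict E hNm
  obtain ⟨hEover, hExor, hEdepth, hEsize⟩ := hE
  refine hN D ⟨hDover hEover, hDxor hExor, hDdepth.trans hEdepth, ?_⟩ ⟨?_, ?_⟩
  · rw [hDsize]
    exact hEsize.trans (Nat.pow_le_pow_right hN1 (Nat.le_succ k))
  · have hfib := card_filter_restrict hNm (fun u : Fin N → Bool => E.eval u = false)
    have h1 : (univ.filter fun w : Fin (N ^ (k + 1)) → Bool => D.eval w = true) =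
        univ.filter fun w : Fin (N ^ (k + 1)) → Bool =>
          E.eval (fun i => w (Fin.castLE hNm i)) = false := by
      ext w
      simp [hDeval w]
    have h2 : #(univ.filter fun u : Fin N → Bool => (s₂ N : ℕ∞) < U.levinKt (List.ofFn u)) ≤
        #(univ.filter fun u : Fin N → Bool => E.eval u = false) :=
      Finset.card_le_card fun u hu => by
        simp only [Finset.mem_filter, Finset.mem_univ, true_and] at hu ⊢
        exact (hsol u).2 (by rw [mem_gapMKtP_no_iff, List.length_ofFn]; exact hu)
    have h3 := two_pow_le_two_mul_card_lt U hN1 hdN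
    have h4 : 2 ^ (N ^ (k + 1)) = 2 ^ (N ^ (k + 1) - N) * 2 ^ N := by
      rw [← pow_add, Nat.sub_add_cancel hNm]
    rw [h1, hfib, h4]
    calc 2 ^ (N ^ (k + 1) - N) * 2 ^ N
        ≤ 2 ^ (N ^ (k + 1) - N) * (2 * #(univ.filter fun u : Fin N → Bool => E.eval u = false)) :=
          Nat.mul_le_mul_left _ (h3.trans (Nat.mul_le_mul_left 2 h2))
      _ = 2 * (2 ^ (N ^ (k + 1) - N) * #(univ.filter fun u : Fin N → Bool => E.eval u = false)) := by
          ring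
  · rintro u ⟨z, hz, rfl⟩
    rw [hDeval]
    have hyes : E.eval (fun i => toInput (N ^ (k + 1))
        (F (boolPair (unaryEncodeNat (N ^ (k + 1))) z)) (Fin.castLE hNm i)) = true := by
      refine (hsol _).1 ?_
      rw [mem_gapMKtP_yes_iff, List.length_ofFn, ofFn_toInput_castLE]
      exact hcN z hz
    simp [hyes]

/-! ### Step 5: the two density regimes, and the consequences for Thm. 1.11 -/

/-- **Prop. 4.22 at the NO threshold `N^α` (`α < 1`), for EVERY reference machine**: a hitting set
generator secure against linear-size `AC⁰_d ∘ XOR` circuits gives, for every `k`, a member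
`MKtP[c log N, N^α]` solved for all large `N` by no `AC⁰_d ∘ XOR` circuit of size `N^k` — the form in
which the proof of Thm. 1.11 (Item 1 ⟹ Item 4, p. 44) consumes Prop. 4.22; density by plain counting
(fewer than `2^{⌊N^α⌋+1} ≤ 2^{N−1}` strings have `Kt ≤ N^α`).
[cite: Hirahara2023NonDisjoint, Prop. 4.22 (p. 39–40) and proof of Thm. 1.11 (p. 44)] -/
theorem prop422_acdXor_powThreshold (U : UniversalMachine) (d : ℕ) (hG : HSGAgainstLinearACdXor d)
    (k : ℕ) {α : ℝ} (hα : α < 1) :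
    ∃ c : ℕ, (U.gapMKtP (logThreshold c) (powThreshold α)).EventuallyUnsolvable
      (IsACdXor d fun N => N ^ k) :=
  hsg_transfer_acdXor U hG (powThreshold α) (by
    filter_upwards [eventually_powThreshold_lt_predThreshold hα] with N hN
    exact card_levinKt_le_of_add_two_le U (by unfold predThreshold at hN; omega)) k

/-- **Prop. 4.22 as typed (`MKtP[c log N, N − 1]`), for every INPUT-BOUNDED reference machine**
(`Oliveira2019.InputBounded`: a program halting within budget `t` has length `≤ k·t`, which supplies
the printed *"standard counting argument"* at the threshold `N − 1`).
[cite: Hirahara2023NonDisjoint, Prop. 4.22 (p. 39–40)] -/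
theorem prop422_acdXor_of_inputBounded (U : UniversalMachine) (hU : Oliveira2019.InputBounded U)
    (d : ℕ) (hG : HSGAgainstLinearACdXor d) (k : ℕ) :
    ∃ c : ℕ, (U.gapMKtP (logThreshold c) predThreshold).EventuallyUnsolvable
      (IsACdXor d fun N => N ^ k) :=
  hsg_transfer_acdXor U hG predThreshold (eventually_card_levinKt_le_pred_of_inputBounded U hU) k

/-- **Item 1 ⟹ Item 4 of Thm. 1.11 for EVERY reference machine, with Prop. 4.22 discharged** (the
vendored hypothesis `h422 : prop422_acdXor` of `thm111Item4_of_item1` is not needed: Item 4 asks for a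
threshold `N^α`, where Prop. 4.22 is `prop422_acdXor_powThreshold`; here `α = 1/2`).
[cite: Hirahara2023NonDisjoint, proof of Thm. 1.11 (p. 44)] -/
theorem thm111Item4_of_thm111Item1 (h1 : Thm111Item1) (U : UniversalMachine) : Thm111Item4 U := by
  intro d k
  obtain ⟨c, hc⟩ := prop422_acdXor_powThreshold U d (h1 d) k (by norm_num : (1 : ℝ) / 2 < 1)
  exact ⟨c, 1 / 2, by norm_num, hc⟩

/-- **Magnification of R29 to `EXP ⊄ NC¹`, with Prop. 4.22 discharged** (cf.
`not_EXP_subset_NC1_of_thm429Hypothesis`): Thm. 4.29 for one machine at all depths, and the author's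
remark after Thm. 1.11, give `EXP ⊄ NC¹`. [cite: Hirahara2023NonDisjoint, Thm. 1.11 and the remark after it (p. 10), Thm. 4.29] -/
theorem not_EXP_subset_NC1_of_thm429 (h429 : thm429) (hC : thm111_consequence) (U : UniversalMachine)
    (hU : ∀ d : ℕ, Thm429Hypothesis U d) : ¬ (EXP ⊆ NC1) :=
  hC U (thm111Item3_of_item4 U
    (thm111Item4_of_thm111Item1 (thm111Item1_of_forall_thm429Hypothesis h429 U hU) U))

/-- Machine-independence, with Prop. 4.22 discharged (cf. `thm111Item4_of_forall_thm429Hypothesis`):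
the R29 hypothesis for one machine `U` gives Item 4 of Thm. 1.11 for ANY machine `U'`.
[cite: Hirahara2023NonDisjoint, Thm. 4.29 and Thm. 1.11 (2 ⟹ 1 ⟹ 4, p. 44)] -/
theorem thm111Item4_of_thm429 (h429 : thm429) (U U' : UniversalMachine)
    (hU : ∀ d : ℕ, Thm429Hypothesis U d) : Thm111Item4 U' :=
  thm111Item4_of_thm111Item1 (thm111Item1_of_forall_thm429Hypothesis h429 U hU) U'

end Literature.Computability.MetaComplexity.Hirahara2020
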